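import Literature.NumberTheory.Automorphic.ArchRankinSelbergTestVectorRankTwoIntegrable
import HarnessLib

/-!
# The torus reduction of the archimedean `GL₂ × GL₂` Rankin–Selberg integral
# (Jacquet (1972), §17–§19; Humphries–Jo (2024), §5, proof of Prop. 5.2)

Topic `NumberTheory/Automorphic`; namespace `Literature.NumberTheory.Automorphic`. Theorems only (no
definition, no named fact, no instance). The STRUCTURAL step of the evaluation of the archimedean
Rankin–Selberg integral `Ψ_∞(s; W_e, W̄'_{e'}, Φ_∞)` of `ArchRankinSelbergTestVector`
(`archRankinSelbergPairIntegralCplx`, rank `2`, Iwasawa coordinates `g = diag(y) k`) at a test function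
which FACTORS along the last row, `Φ_∞(e₂ diag(y) k) = g(y₂) · P(k)` (the shape of every
`Φ = P · exp(-d_F π x ᵗx̄)` with `P` homogeneous, Humphries–Jo (2024), (5.3): `Φ(z e₂ k) = χ(z) e^{-d_F π |z|²} P(e₂ k)`),
for representations `τ, τ'` on which the centre acts by scalars `ω, ω'`:

* `archTorusWeightC_two_snoc_mul` — in the coordinates `y = c · (t, 1)` of `(K_∞ˣ)²` the weight
  `|det y|^s δ_B(y)⁻¹` is `N(c)^{2s} N(t)^{s-1}` (complex powers);
* `archRankinSelbergPairIntegralCplx_two_eq_torus` (**main**) — the printed first step of the proof of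
  Humphries–Jo (2024), Prop. 5.2 ("By the Iwasawa decomposition `g = z (h 1) k` … `Ψ` is equal to
  `∫_{F^×} ω_π ω_σ(z) |z|^{ns} ∫ |det h|^{s-1} ∫_{K_n} W_π((h 1)k) W_σ((h 1)k) Φ(z e_n k) dk dh d^×z`"), for `n = 2`
  and in the tree's coordinates: if the integrand of `Ψ_∞(s)` is integrable, then
  `Ψ_∞(s; W_e, W̄'_{e'}, Φ_∞) = κ · (∫_{K_∞ˣ} ω ω̄'(c) g(c) N(c)^{2s} dμ_c) ·
     ∫_{K_∞ˣ} (∫_{K_∞} P(k) W_{τ(k)e}(a(t)) conj W'_{τ'(k)e'}(a(t)) dμ_K) N(t)^{s-1} dμ₁(t)`,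
  where `W_v(a(t)) = ℓ(τ(diag(t,1)) v)` is the Kirillov function (`kirillovFn`), `μ_A = κ · (μ₁ × μ_c)_*`
  under `(t, c) ↦ c · (t, 1)` (`exists_eq_smul_map_snoc_mul`): the centre acts through `ω`, `ω'`
  (`W(diag(tc, c) k) = ω(c) W_{τ(k)e}(a(t))`), the weight splits, and Fubini. No irreducibility,
  unitarity, `K_∞`-finiteness or continuity is needed beyond the integrability hypothesis;
* `archRankinSelbergPairIntegralCplx_two_eq_torus_of_polyGaussian` — the same under the hypotheses of the
  named fact `HumphriesJo2024_archRankinSelberg_testVector 2 K` (irreducible unitary `τ, τ'`, continuous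
  Whittaker functionals, `K_∞`-finite Gårding `e, e'`, `Φ_∞` polynomial-times-Gaussian, `re s > 1`), the
  integrability being `HumphriesJo2024_archRankinSelberg_testVector_two_integrable` and the central
  characters Schur's lemma (`exists_apply_glDiagonal_const_eq_smul`).

This isolates the representation-theoretic content of clause (i) of the fact (Humphries–Jo (2024),
Thm. 5.6) in the `K_∞`-average `H(t) = ∫_{K_∞} P(k) W_{τ(k)e}(a(t)) conj W'_{τ'(k)e'}(a(t)) dμ_K` of the
product of the two Kirillov functions and in Tate's integral `∫ ω ω̄' g N^{2s}`; neither is evaluated here.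

## References

* P. Humphries, Y. Jo, *Test vectors for archimedean period integrals*, Publ. Mat. 68 (2024),
  §5, Prop. 5.2 and its proof, Thm. 5.6 [HumphriesJo2024].
* H. Jacquet, *Automorphic Forms on GL(2), Part II*, LNM 278 (1972), §17–§19 [Jacquet1972GL2II].
* J. W. Cogdell, *Analytic theory of L-functions for GL_n* (2004), §3.1 item (1), §3.2
  [CogdellAnalyticTheory2004].
-/

noncomputable section

open MeasureTheory Measure NumberField NumberField.mixedEmbedding NumberField.InfinitePlace IsDedekindDomain Set Filter
open scoped MatrixGroups ENNReal NNReal Classical ComplexConjugate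

namespace Literature.NumberTheory.Automorphic

-- as in `ArchGardingWhittaker` / `ArchRankinSelbergIntegrableGL2`
set_option backward.isDefEq.respectTransparency false

variable {K : Type} [Field K] [NumberField K]

/-! ### 1. The complex torus weight in the coordinates `y = c · (t, 1)` -/

section Weight

/-- **`|det y|^s δ_B(y)⁻¹ = N(c)^{2s} N(t)^{s-1}` for `y = c · (t, 1) ∈ (K_∞ˣ)²`** (complex powers of the
positive reals `N(c)`, `N(t)`; the real-exponent version is `archTorusWeight_two_snoc_mul`). [folklore] -/
theorem archTorusWeightC_two_snoc_mul (s : ℂ) (y' : Fin 1 → (mixedSpace K)ˣ) (c : (mixedSpace K)ˣ) :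
    archTorusWeightC 2 K s (fun i => Fin.snoc (α := fun _ => (mixedSpace K)ˣ) y' 1 i * c) =
      ((mixedEmbedding.norm (c : mixedSpace K) : ℝ) : ℂ) ^ (2 * s) *
        ((mixedEmbedding.norm ((y' 0 : (mixedSpace K)ˣ) : mixedSpace K) : ℝ) : ℂ) ^ (s - 1) := by
  have hc0 : 0 < mixedEmbedding.norm (c : mixedSpace K) := mixedEmbedding_norm_units_pos c
  have hc0' : ((mixedEmbedding.norm (c : mixedSpace K) : ℝ) : ℂ) ≠ 0 := Complex.ofReal_ne_zero.mpr hc0.ne'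
  unfold archTorusWeightC
  rw [Fin.prod_univ_castSucc, Fin.prod_univ_one]
  simp only [Fin.snoc_castSucc, Fin.snoc_last, one_mul, Fin.val_castSucc, Fin.val_last, Fin.val_zero,
    Units.val_mul, map_mul, Nat.cast_zero, Nat.cast_one, Nat.cast_ofNat, mul_zero, sub_zero]
  have e1 : (s - (((2 : ℝ) - 1 : ℝ) : ℂ)) = s - 1 := by push_cast; ring
  have e2 : (s - (((2 : ℝ) - 1 - 2 * 1 : ℝ) : ℂ)) = s + 1 := by push_cast; ring
  rw [e1, e2, Complex.ofReal_mul, Complex.mul_cpow_ofReal_nonneg (mixedEmbedding.norm_nonneg _) (mixedEmbedding.norm_nonneg _)]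
  have hsplit : ((mixedEmbedding.norm (c : mixedSpace K) : ℝ) : ℂ) ^ (2 * s) =
      ((mixedEmbedding.norm (c : mixedSpace K) : ℝ) : ℂ) ^ (s - 1) *
        ((mixedEmbedding.norm (c : mixedSpace K) : ℝ) : ℂ) ^ (s + 1) := by
    rw [← Complex.cpow_add _ _ hc0']
    congr 1
    ring
  rw [hsplit]
  ring

end Weight

/-! ### 2. The torus reduction -/

section Torus

variable (hcpt : isCompact_glFiniteIntegralLevel 2 K)
  {E : Type*} [NormedAddCommGroup E] [NormedSpace ℂ E] [CompleteSpace E]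
  {E' : Type*} [NormedAddCommGroup E'] [NormedSpace ℂ E'] [CompleteSpace E']
  (τ : ContRepresentation ℂ (AutomorphyDatum.gl 2 K hcpt).arch.carrier E) (hτ : τ.IsStronglyContinuous)
  (τ' : ContRepresentation ℂ (AutomorphyDatum.gl 2 K hcpt).arch.carrier E') (hτ' : τ'.IsStronglyContinuous)

set_option maxHeartbeats 4000000 in
/-- **The torus reduction of `Ψ_∞(s; W_e, W̄'_{e'}, Φ_∞)` for `GL₂(K_∞)`** (the first step of the proof of
Humphries–Jo (2024), Prop. 5.2, `n = 2`; Jacquet (1972), §17–§19). Let the centre of `GL₂(K_∞)` act in `τ`, `τ'`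
by the scalars `ω`, `ω'`, let `Φ_∞` factor along the last row of `diag(y) k`, `k ∈ K_∞`, as
`Φ_∞(e₂ diag(y) k) = g(y₂) P(k)`, let `μ_A = κ · (μ₁ × μ_c)_*` under `(t, c) ↦ c · (t, 1)` (any Haar measure
is of this form, `exists_eq_smul_map_snoc_mul`), and let the integrand of `Ψ_∞(s)` be integrable. Then
`Ψ_∞(s; W_e, W̄'_{e'}, Φ_∞) = κ · (∫ ω(c) conj ω'(c) g(c) N(c)^{2s} dμ_c) ·
  ∫ (∫_{K_∞} P(k) W_{τ(k)e}(a(t)) conj W'_{τ'(k)e'}(a(t)) dμ_K) N(t)^{s-1} dμ₁(t)`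
(`W_v(a(t)) = kirillovFn`): `diag(tc, c) k = diag(t, 1) · k · (c · 1)`, the centre acts through `ω, ω'`,
the weight is `N(c)^{2s} N(t)^{s-1}` (`archTorusWeightC_two_snoc_mul`), and Fubini.
[cite: HumphriesJo2024, §5, proof of Prop. 5.2 (p. 152)] -/
theorem archRankinSelbergPairIntegralCplx_two_eq_torus
    (ℓ : archGardingSpace hcpt τ →ₗ[ℂ] ℂ) (ℓ' : archGardingSpace hcpt τ' →ₗ[ℂ] ℂ)
    (e : archGardingSpace hcpt τ) (e' : archGardingSpace hcpt τ')
    {ω ω' : (mixedSpace K)ˣ → ℂ}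
    (hω : ∀ (c : (mixedSpace K)ˣ) (v : E), τ (toArch hcpt (glDiagonal 2 (mixedSpace K) fun _ => c)) v = ω c • v)
    (hω' : ∀ (c : (mixedSpace K)ˣ) (v : E'), τ' (toArch hcpt (glDiagonal 2 (mixedSpace K) fun _ => c)) v = ω' c • v)
    (Φinf : (Fin 2 → InfiniteAdeleRing K) → ℂ) {g : (mixedSpace K)ˣ → ℂ} {Pk : GL (Fin 2) (mixedSpace K) → ℂ}
    (hΦ : ∀ (y : Fin 2 → (mixedSpace K)ˣ) (k : GL (Fin 2) (mixedSpace K)), k ∈ Kinf 2 K →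
      Φinf (archLastRow 2 K (glDiagonal 2 (mixedSpace K) y * k)) = g (y (Fin.last 1)) * Pk k)
    [MeasurableSpace (GL (Fin 2) (mixedSpace K))] [BorelSpace (GL (Fin 2) (mixedSpace K))]
    [MeasurableSpace ((mixedSpace K)ˣ)] [BorelSpace ((mixedSpace K)ˣ)]
    (μA : Measure (Fin 2 → (mixedSpace K)ˣ)) (μK : Measure ↥(Kinf 2 K)) [SFinite μK]
    (μA' : Measure (Fin 1 → (mixedSpace K)ˣ)) [SFinite μA'] (μc : Measure (mixedSpace K)ˣ) [SFinite μc]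
    (κ : ℝ≥0∞)
    (hμA : μA = κ • (μA'.prod μc).map
      (fun p : (Fin 1 → (mixedSpace K)ˣ) × (mixedSpace K)ˣ => fun i => Fin.snoc (α := fun _ => (mixedSpace K)ˣ) p.1 1 i * p.2))
    (s : ℂ)
    (hint : Integrable (fun p : (Fin 2 → (mixedSpace K)ˣ) × ↥(Kinf 2 K) =>
        ℓ ⟨τ (toArch hcpt (glDiagonal 2 (mixedSpace K) p.1 * (p.2 : GL (Fin 2) (mixedSpace K)))) (e : E),
            apply_mem_archGardingSpace hτ _ e.2⟩ *
          conj (ℓ' ⟨τ' (toArch hcpt (glDiagonal 2 (mixedSpace K) p.1 * (p.2 : GL (Fin 2) (mixedSpace K))))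
            (e' : E'), apply_mem_archGardingSpace hτ' _ e'.2⟩) *
          Φinf (archLastRow 2 K (glDiagonal 2 (mixedSpace K) p.1 * (p.2 : GL (Fin 2) (mixedSpace K)))) *
          archTorusWeightC 2 K s p.1) (μA.prod μK)) :
    archRankinSelbergPairIntegralCplx hcpt τ hτ τ' hτ' ℓ ℓ' e e' Φinf μA μK s =
      (κ.toReal : ℂ) *
        (∫ c, ω c * conj (ω' c) * g c * ((mixedEmbedding.norm (c : mixedSpace K) : ℝ) : ℂ) ^ (2 * s) ∂μc) *
        ∫ y' : Fin 1 → (mixedSpace K)ˣ, (∫ k : ↥(Kinf 2 K), Pk (k : GL (Fin 2) (mixedSpace K)) *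
            (kirillovFn hτ ℓ ⟨τ (toArch hcpt (k : GL (Fin 2) (mixedSpace K))) (e : E), apply_mem_archGardingSpace hτ _ e.2⟩ (y' 0) *
              conj (kirillovFn hτ' ℓ' ⟨τ' (toArch hcpt (k : GL (Fin 2) (mixedSpace K))) (e' : E'),
                apply_mem_archGardingSpace hτ' _ e'.2⟩ (y' 0))) ∂μK) *
          ((mixedEmbedding.norm ((y' 0 : (mixedSpace K)ˣ) : mixedSpace K) : ℝ) : ℂ) ^ (s - 1) ∂μA' := by
  haveI : BorelSpace (Fin 1 → (mixedSpace K)ˣ) := Pi.borelSpace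
  haveI : BorelSpace (Fin 2 → (mixedSpace K)ˣ) := Pi.borelSpace
  -- the coordinate change and the integrand
  set Θ : (Fin 1 → (mixedSpace K)ˣ) × (mixedSpace K)ˣ → (Fin 2 → (mixedSpace K)ˣ) := fun p i =>
    Fin.snoc (α := fun _ => (mixedSpace K)ˣ) p.1 1 i * p.2 with hΘ
  have hΘc : Continuous Θ := by
    refine continuous_pi fun i => ?_
    refine Fin.lastCases ?_ (fun j => ?_) i
    · have h : (fun p : (Fin 1 → (mixedSpace K)ˣ) × (mixedSpace K)ˣ => Θ p (Fin.last 1)) = fun p => p.2 := by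
        funext p
        change Fin.snoc (α := fun _ => (mixedSpace K)ˣ) p.1 1 (Fin.last 1) * p.2 = p.2
        rw [Fin.snoc_last, one_mul]
      rw [h]
      exact continuous_snd
    · have h : (fun p : (Fin 1 → (mixedSpace K)ˣ) × (mixedSpace K)ˣ => Θ p j.castSucc) = fun p => p.1 j * p.2 := by
        funext p
        change Fin.snoc (α := fun _ => (mixedSpace K)ˣ) p.1 1 j.castSucc * p.2 = p.1 j * p.2
        rw [Fin.snoc_castSucc]
      rw [h]
      exact ((continuous_apply j).comp continuous_fst).mul continuous_snd
  have hΘm : Measurable Θ := hΘc.measurable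
  set F : (Fin 2 → (mixedSpace K)ˣ) × ↥(Kinf 2 K) → ℂ := fun p =>
    ℓ ⟨τ (toArch hcpt (glDiagonal 2 (mixedSpace K) p.1 * (p.2 : GL (Fin 2) (mixedSpace K)))) (e : E),
        apply_mem_archGardingSpace hτ _ e.2⟩ *
      conj (ℓ' ⟨τ' (toArch hcpt (glDiagonal 2 (mixedSpace K) p.1 * (p.2 : GL (Fin 2) (mixedSpace K))))
        (e' : E'), apply_mem_archGardingSpace hτ' _ e'.2⟩) *
      Φinf (archLastRow 2 K (glDiagonal 2 (mixedSpace K) p.1 * (p.2 : GL (Fin 2) (mixedSpace K)))) *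
      archTorusWeightC 2 K s p.1 with hF
  -- the three factors after the change of variables
  set fC : (mixedSpace K)ˣ → ℂ := fun c =>
    ω c * conj (ω' c) * g c * ((mixedEmbedding.norm (c : mixedSpace K) : ℝ) : ℂ) ^ (2 * s) with hfC
  set Gk : (Fin 1 → (mixedSpace K)ˣ) → ↥(Kinf 2 K) → ℂ := fun y' k => Pk (k : GL (Fin 2) (mixedSpace K)) *
    (kirillovFn hτ ℓ ⟨τ (toArch hcpt (k : GL (Fin 2) (mixedSpace K))) (e : E), apply_mem_archGardingSpace hτ _ e.2⟩ (y' 0) *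
      conj (kirillovFn hτ' ℓ' ⟨τ' (toArch hcpt (k : GL (Fin 2) (mixedSpace K))) (e' : E'),
        apply_mem_archGardingSpace hτ' _ e'.2⟩ (y' 0))) with hGk
  set Ny : (Fin 1 → (mixedSpace K)ˣ) → ℂ := fun y' =>
    ((mixedEmbedding.norm ((y' 0 : (mixedSpace K)ˣ) : mixedSpace K) : ℝ) : ℂ) ^ (s - 1) with hNy
  -- ### the pointwise identity `F(c · (t,1), k) = fC(c) · (Gk t k · N(t)^{s-1})`
  have hpt : ∀ q : ((Fin 1 → (mixedSpace K)ˣ) × (mixedSpace K)ˣ) × ↥(Kinf 2 K),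
      F (Prod.map Θ id q) = fC q.1.2 * (Gk q.1.1 q.2 * Ny q.1.1) := by
    rintro ⟨⟨y', c⟩, k⟩
    simp only [Prod.map_apply, id_eq]
    -- the vectors: the centre acts by `ω`, the torus through `a(t)`, and `k` on `e`
    have hmul : toArch hcpt (diagGL2 (y' 0) 1 * ((k : GL (Fin 2) (mixedSpace K)) *
          glDiagonal 2 (mixedSpace K) (fun _ => c))) =
        toArch hcpt (diagGL2 (y' 0) 1) * (toArch hcpt (k : GL (Fin 2) (mixedSpace K)) *
          toArch hcpt (glDiagonal 2 (mixedSpace K) (fun _ => c))) := rfl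
    have hgrp : glDiagonal 2 (mixedSpace K) (Θ (y', c)) * (k : GL (Fin 2) (mixedSpace K)) =
        diagGL2 (y' 0) 1 * ((k : GL (Fin 2) (mixedSpace K)) * glDiagonal 2 (mixedSpace K) (fun _ => c)) := by
      change glDiagonal 2 (mixedSpace K) (fun i => Fin.snoc (α := fun _ => (mixedSpace K)ˣ) y' 1 i * c) *
          (k : GL (Fin 2) (mixedSpace K)) = _
      rw [glDiagonal_snoc_mul, mul_assoc, glDiagonal_const_mul_comm c, glDiagonal_snoc_one_eq_diagGL2]
    have hvec : τ (toArch hcpt (glDiagonal 2 (mixedSpace K) (Θ (y', c)) * (k : GL (Fin 2) (mixedSpace K)))) (e : E) =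
        ω c • τ (toArch hcpt (diagGL2 (y' 0) 1))
          (τ (toArch hcpt (k : GL (Fin 2) (mixedSpace K))) (e : E)) := by
      rw [hgrp, hmul, map_mul, map_mul, ContinuousLinearMap.mul_def, ContinuousLinearMap.mul_def,
        ContinuousLinearMap.comp_apply, ContinuousLinearMap.comp_apply, hω, map_smul, map_smul]
    have hvec' : τ' (toArch hcpt (glDiagonal 2 (mixedSpace K) (Θ (y', c)) * (k : GL (Fin 2) (mixedSpace K)))) (e' : E') =
        ω' c • τ' (toArch hcpt (diagGL2 (y' 0) 1))
          (τ' (toArch hcpt (k : GL (Fin 2) (mixedSpace K))) (e' : E')) := by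
      rw [hgrp, hmul, map_mul, map_mul, ContinuousLinearMap.mul_def, ContinuousLinearMap.mul_def,
        ContinuousLinearMap.comp_apply, ContinuousLinearMap.comp_apply, hω', map_smul, map_smul]
    have hW : ℓ ⟨τ (toArch hcpt (glDiagonal 2 (mixedSpace K) (Θ (y', c)) * (k : GL (Fin 2) (mixedSpace K)))) (e : E),
          apply_mem_archGardingSpace hτ _ e.2⟩ =
        ω c * kirillovFn hτ ℓ ⟨τ (toArch hcpt (k : GL (Fin 2) (mixedSpace K))) (e : E),
          apply_mem_archGardingSpace hτ _ e.2⟩ (y' 0) := by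
      have hsub : (⟨τ (toArch hcpt (glDiagonal 2 (mixedSpace K) (Θ (y', c)) * (k : GL (Fin 2) (mixedSpace K)))) (e : E),
            apply_mem_archGardingSpace hτ _ e.2⟩ : archGardingSpace hcpt τ) =
          ω c • ⟨τ (toArch hcpt (diagGL2 (y' 0) 1)) (τ (toArch hcpt (k : GL (Fin 2) (mixedSpace K))) (e : E)),
            apply_mem_archGardingSpace hτ _ (apply_mem_archGardingSpace hτ _ e.2)⟩ :=
        Subtype.ext hvec
      rw [hsub, map_smul, smul_eq_mul, kirillovFn_apply]
    have hW' : ℓ' ⟨τ' (toArch hcpt (glDiagonal 2 (mixedSpace K) (Θ (y', c)) * (k : GL (Fin 2) (mixedSpace K)))) (e' : E'),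
          apply_mem_archGardingSpace hτ' _ e'.2⟩ =
        ω' c * kirillovFn hτ' ℓ' ⟨τ' (toArch hcpt (k : GL (Fin 2) (mixedSpace K))) (e' : E'),
          apply_mem_archGardingSpace hτ' _ e'.2⟩ (y' 0) := by
      have hsub : (⟨τ' (toArch hcpt (glDiagonal 2 (mixedSpace K) (Θ (y', c)) * (k : GL (Fin 2) (mixedSpace K)))) (e' : E'),
            apply_mem_archGardingSpace hτ' _ e'.2⟩ : archGardingSpace hcpt τ') =
          ω' c • ⟨τ' (toArch hcpt (diagGL2 (y' 0) 1)) (τ' (toArch hcpt (k : GL (Fin 2) (mixedSpace K))) (e' : E')),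
            apply_mem_archGardingSpace hτ' _ (apply_mem_archGardingSpace hτ' _ e'.2)⟩ :=
        Subtype.ext hvec'
      rw [hsub, map_smul, smul_eq_mul, kirillovFn_apply]
    -- the test function and the weight
    have hlast : Θ (y', c) (Fin.last 1) = c := by
      change Fin.snoc (α := fun _ => (mixedSpace K)ˣ) y' 1 (Fin.last 1) * c = c
      rw [Fin.snoc_last, one_mul]
    have hΦ' : Φinf (archLastRow 2 K (glDiagonal 2 (mixedSpace K) (Θ (y', c)) * (k : GL (Fin 2) (mixedSpace K)))) =
        g c * Pk (k : GL (Fin 2) (mixedSpace K)) := by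
      rw [hΦ _ _ k.2, hlast]
    have hwt : archTorusWeightC 2 K s (Θ (y', c)) =
        ((mixedEmbedding.norm (c : mixedSpace K) : ℝ) : ℂ) ^ (2 * s) * Ny y' :=
      archTorusWeightC_two_snoc_mul s y' c
    simp only [hF, hfC, hGk]
    rw [hW, hW', hΦ', hwt, map_mul]
    ring
  -- ### degenerate multiples
  have hLHS : archRankinSelbergPairIntegralCplx hcpt τ hτ τ' hτ' ℓ ℓ' e e' Φinf μA μK s = ∫ p, F p ∂(μA.prod μK) := rfl
  have hprod : μA.prod μK = κ • ((Measure.map Θ (μA'.prod μc)).prod μK) := by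
    rw [hμA, Measure.prod_smul_left]
  have hmap : (Measure.map Θ (μA'.prod μc)).prod μK = Measure.map (Prod.map Θ id) ((μA'.prod μc).prod μK) := by
    have h := Measure.map_prod_map (μA'.prod μc) μK hΘm measurable_id
    rwa [Measure.map_id] at h
  rw [hLHS, hprod, integral_smul_measure, hmap]
  by_cases hκ : κ = 0 ∨ κ = ⊤
  · have h0 : κ.toReal = 0 := by
      rcases hκ with h | h
      · rw [h, ENNReal.toReal_zero]
      · rw [h, ENNReal.toReal_top]
    rw [h0, zero_smul, Complex.ofReal_zero, zero_mul, zero_mul]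
  push Not at hκ
  -- ### integrability after the change of variables
  have hint' : Integrable F (Measure.map (Prod.map Θ id) ((μA'.prod μc).prod μK)) := by
    rw [hprod, hmap] at hint
    exact (integrable_smul_measure hκ.1 hκ.2).1 hint
  have hΘm' : AEMeasurable (Prod.map Θ id) ((μA'.prod μc).prod μK) := (hΘm.prodMap measurable_id).aemeasurable
  have hcomp : Integrable (F ∘ Prod.map Θ id) ((μA'.prod μc).prod μK) :=
    (integrable_map_measure hint'.aestronglyMeasurable hΘm').1 hint'
  rw [integral_map hΘm' hint'.aestronglyMeasurable]
  have hfun : (fun q : ((Fin 1 → (mixedSpace K)ˣ) × (mixedSpace K)ˣ) × ↥(Kinf 2 K) => F (Prod.map Θ id q)) =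
      fun q => fC q.1.2 * (Gk q.1.1 q.2 * Ny q.1.1) := funext hpt
  have hcomp' : Integrable (fun q : ((Fin 1 → (mixedSpace K)ˣ) × (mixedSpace K)ˣ) × ↥(Kinf 2 K) =>
      fC q.1.2 * (Gk q.1.1 q.2 * Ny q.1.1)) ((μA'.prod μc).prod μK) := by
    have h : (F ∘ Prod.map Θ id) = fun q => fC q.1.2 * (Gk q.1.1 q.2 * Ny q.1.1) := funext hpt
    rwa [h] at hcomp
  rw [hfun, integral_prod _ hcomp']
  -- ### Fubini and the product structure
  have hinner : ∀ z : (Fin 1 → (mixedSpace K)ˣ) × (mixedSpace K)ˣ,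
      ∫ k : ↥(Kinf 2 K), fC z.2 * (Gk z.1 k * Ny z.1) ∂μK = fC z.2 * ((∫ k, Gk z.1 k ∂μK) * Ny z.1) := fun z => by
    rw [integral_const_mul, integral_mul_const]
  simp_rw [hinner]
  have hsplit : ∫ z : (Fin 1 → (mixedSpace K)ˣ) × (mixedSpace K)ˣ, fC z.2 * ((∫ k, Gk z.1 k ∂μK) * Ny z.1) ∂(μA'.prod μc) =
      (∫ y', (∫ k, Gk y' k ∂μK) * Ny y' ∂μA') * ∫ c, fC c ∂μc := by
    rw [← integral_prod_mul]
    refine integral_congr_ae (Eventually.of_forall fun z => ?_)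
    ring
  rw [hsplit, Complex.real_smul]
  ring

end Torus

/-! ### 3. Under the hypotheses of the named fact -/

section Fact

variable (hcpt : isCompact_glFiniteIntegralLevel 2 K)
  {E : Type} [NormedAddCommGroup E] [InnerProductSpace ℂ E] [CompleteSpace E]
  {E' : Type} [NormedAddCommGroup E'] [InnerProductSpace ℂ E'] [CompleteSpace E']
  (τ : ContRepresentation ℂ (AutomorphyDatum.gl 2 K hcpt).arch.carrier E) (hτ : τ.IsStronglyContinuous)
  (τ' : ContRepresentation ℂ (AutomorphyDatum.gl 2 K hcpt).arch.carrier E') (hτ' : τ'.IsStronglyContinuous)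

/-- **The torus reduction under the hypotheses of `HumphriesJo2024_archRankinSelberg_testVector 2 K`.** For
irreducible unitary `τ, τ'` on `GL₂(K_∞)` with central characters `ω, ω'`, continuous `ψ_∞`-Whittaker
functionals `ℓ, ℓ'`, `K_∞`-finite Gårding `e, e'`, a polynomial-times-Gaussian `Φ_∞` factoring along the last
row as `Φ_∞(e₂ diag(y) k) = g(y₂) P(k)` (`k ∈ K_∞`), and Haar measures `μ_A, μ_K, μ₁, μ_c`, there is `κ > 0` with,
for every `re s > 1`,
`Ψ_∞(s; W_e, W̄'_{e'}, Φ_∞) = κ · (∫ ω conj ω' · g · N^{2s} dμ_c) ·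
  ∫ (∫_{K_∞} P(k) W_{τ(k)e}(a(t)) conj W'_{τ'(k)e'}(a(t)) dμ_K) N(t)^{s-1} dμ₁(t)`
(`archRankinSelbergPairIntegralCplx_two_eq_torus`, the integrability being clause (ii) of the fact,
`HumphriesJo2024_archRankinSelberg_testVector_two_integrable`, and `μ_A = κ (μ₁ × μ_c)_*` by
`exists_eq_smul_map_snoc_mul`). The first step of Humphries–Jo (2024), proof of Prop. 5.2, at `n = 2`.
[cite: HumphriesJo2024, §5, proof of Prop. 5.2 (p. 152)] -/
theorem archRankinSelbergPairIntegralCplx_two_eq_torus_of_polyGaussian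
    (hτu : τ.IsUnitary) (hτi : τ.IsTopIrreducible)
    (ℓ : archGardingSpace hcpt τ →ₗ[ℂ] ℂ) (hℓ : IsArchContWhittakerFunctional hcpt τ hτ ℓ)
    (hτu' : τ'.IsUnitary) (hτi' : τ'.IsTopIrreducible)
    (ℓ' : archGardingSpace hcpt τ' →ₗ[ℂ] ℂ) (hℓ' : IsArchContWhittakerFunctional hcpt τ' hτ' ℓ')
    (e : archGardingSpace hcpt τ) (e' : archGardingSpace hcpt τ')
    (he : FiniteDimensional ℂ (Submodule.span ℂ (Set.range
      fun κ : (AutomorphyDatum.gl 2 K hcpt).arch.maximalCompact => τ (toArch hcpt (κ : GL (Fin 2) (mixedSpace K))) (e : E))))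
    (he' : FiniteDimensional ℂ (Submodule.span ℂ (Set.range
      fun κ : (AutomorphyDatum.gl 2 K hcpt).arch.maximalCompact => τ' (toArch hcpt (κ : GL (Fin 2) (mixedSpace K))) (e' : E'))))
    {ω ω' : (mixedSpace K)ˣ → ℂ}
    (hω : ∀ (c : (mixedSpace K)ˣ) (v : E), τ (toArch hcpt (glDiagonal 2 (mixedSpace K) fun _ => c)) v = ω c • v)
    (hω' : ∀ (c : (mixedSpace K)ˣ) (v : E'), τ' (toArch hcpt (glDiagonal 2 (mixedSpace K) fun _ => c)) v = ω' c • v)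
    (Φinf : (Fin 2 → InfiniteAdeleRing K) → ℂ) (hΦpg : IsArchPolyGaussian 2 K Φinf)
    {g : (mixedSpace K)ˣ → ℂ} {Pk : GL (Fin 2) (mixedSpace K) → ℂ}
    (hΦ : ∀ (y : Fin 2 → (mixedSpace K)ˣ) (k : GL (Fin 2) (mixedSpace K)), k ∈ Kinf 2 K →
      Φinf (archLastRow 2 K (glDiagonal 2 (mixedSpace K) y * k)) = g (y (Fin.last 1)) * Pk k)
    [MeasurableSpace (GL (Fin 2) (mixedSpace K))] [BorelSpace (GL (Fin 2) (mixedSpace K))]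
    [MeasurableSpace ((mixedSpace K)ˣ)] [BorelSpace ((mixedSpace K)ˣ)]
    (μA : Measure (Fin 2 → (mixedSpace K)ˣ)) [IsHaarMeasure μA] (μK : Measure ↥(Kinf 2 K)) [IsHaarMeasure μK]
    (μA' : Measure (Fin 1 → (mixedSpace K)ˣ)) [IsHaarMeasure μA'] (μc : Measure (mixedSpace K)ˣ) [IsHaarMeasure μc] :
    ∃ κ : ℝ, 0 < κ ∧ ∀ s : ℂ, 1 < s.re →
      archRankinSelbergPairIntegralCplx hcpt τ hτ τ' hτ' ℓ ℓ' e e' Φinf μA μK s =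
        (κ : ℂ) *
          (∫ c, ω c * conj (ω' c) * g c * ((mixedEmbedding.norm (c : mixedSpace K) : ℝ) : ℂ) ^ (2 * s) ∂μc) *
          ∫ y' : Fin 1 → (mixedSpace K)ˣ, (∫ k : ↥(Kinf 2 K), Pk (k : GL (Fin 2) (mixedSpace K)) *
              (kirillovFn hτ ℓ ⟨τ (toArch hcpt (k : GL (Fin 2) (mixedSpace K))) (e : E), apply_mem_archGardingSpace hτ _ e.2⟩ (y' 0) *
                conj (kirillovFn hτ' ℓ' ⟨τ' (toArch hcpt (k : GL (Fin 2) (mixedSpace K))) (e' : E'),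
                  apply_mem_archGardingSpace hτ' _ e'.2⟩ (y' 0))) ∂μK) *
            ((mixedEmbedding.norm ((y' 0 : (mixedSpace K)ˣ) : mixedSpace K) : ℝ) : ℂ) ^ (s - 1) ∂μA' := by
  haveI : BorelSpace (Fin 1 → (mixedSpace K)ˣ) := Pi.borelSpace
  haveI : CompactSpace ↥(Kinf 2 K) := isCompact_iff_compactSpace.mp (isCompact_Kinf_holds 2 K)
  obtain ⟨κ, hκT, hμA⟩ := exists_eq_smul_map_snoc_mul (n := 1) (K := K) μA μA' μc
  have hκ0 : κ ≠ 0 := by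
    intro h0
    rw [h0, zero_smul] at hμA
    have h := IsOpenPosMeasure.open_pos (μ := μA) _ isOpen_univ univ_nonempty
    rw [hμA] at h
    exact h rfl
  refine ⟨κ.toReal, ENNReal.toReal_pos hκ0 hκT, fun s hs => ?_⟩
  have hint := HumphriesJo2024_archRankinSelberg_testVector_two_integrable K hcpt E τ hτ hτu hτi ℓ hℓ E' τ' hτ' hτu' hτi'
    ℓ' hℓ' μA ‹_› μK ‹_› e e' he he' Φinf hΦpg s hs
  exact archRankinSelbergPairIntegralCplx_two_eq_torus hcpt τ hτ τ' hτ' ℓ ℓ' e e' hω hω' Φinf hΦ μA μK μA' μc κ hμA s hint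

end Fact

end Literature.NumberTheory.Automorphic
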